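import Mathlib
import HarnessLib
import Literature.RingTheory.Valuation.AlgClosedResidue
import Literature.NumberTheory.DiophantineGeometry.BelyiPairReduction

/-!
# Depth of a Belyi pair at the Gauss point: deep pairs, the formula centre, entering a class

(Layer 3a of the bad-prime floor for the Belyi degree.)  For a Belyi pair `(p, q)` over an
algebraically closed field with a valuation subring `A` we say the Gauss point is **deep** when the
rational function `p/q` is, on the generic residue classes, closer to some constant `a` than that
constant is to `0`, `1` and `∞`: `|p - a q| < r_Y(a) |q|` with `r_Y(a) = min (v a, v (a-1), 1)`
(the image of the Gauss point lies OFF the tripod spanned by `0, 1, ∞`).  We prove: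

* `IsDeepPair.redPoly_eq` — a deep pair is *fully neutral*: `p`, `q`, `p - q` have the same reduction
  (so every residue class contains as many zeros as poles as ones);
* `IsBelyiPair.isDeepPair_centre` — if deep for some `a`, then deep for the formula centre of
  `optimal_centre`, with the same `r_Y`;
* `IsDeepPair.entering` — **entering lemma**: if a residue class `v` with special points is not a
  pole of the (non-constant) reduction `χ` of `(p - a q)/(b q)`, then for a suitable `λ = a + b t` the
  class `v` contains MORE roots of `p - λ q` than poles;
* `IsDeepPair.false_of_forall_shallow` — **all-shallow contradiction**: it is impossible that every
  residue class with special points is a pole of `χ` and `∞` is one too (two-point Riemann–Hurwitz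
  + unramified special-free classes).

Folklore (non-archimedean geometry of `ℙ¹`: the Gauss point maps into the skeleton of the target);
everything proved, no named facts.
-/

noncomputable section

namespace Literature.NumberTheory.DiophantineGeometry

open Polynomial IsLocalRing Literature.RingTheory.Valuation
open scoped Classical

section Lift

variable {K : Type*} [Field K] (A : ValuationSubring K)

/-- A polynomial of Gauss value `≤ 1` has coefficients in `A`. [folklore] -/
theorem exists_map_eq_of_gaussVal_le_one {f : K[X]} (hf : gaussVal A f ≤ 1) :
    ∃ g : A[X], g.map (algebraMap A K) = f := by
  have : f ∈ lifts (algebraMap A K) := by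
    rw [lifts_iff_coeff_lifts]
    intro n
    have hn : A.valuation (f.coeff n) ≤ 1 := (valuation_coeff_le_gaussVal A f n).trans hf
    exact ⟨⟨f.coeff n, (A.valuation_le_one_iff _).mp hn⟩, rfl⟩
  exact (mem_lifts _).mp this

variable {A}

/-- **Lift with a prescribed constant.**  If `v(c) · gaussVal f = 1` then `c f` has an integral
model whose reduction is a non-zero constant multiple of `redPoly A f`. [folklore] -/
theorem exists_lift_eq_C_mul [Nontrivial (ResidueField A)] {f : K[X]} (hs : f.Splits)
    {c : K} (hc : A.valuation c * gaussVal A f = 1) :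
    ∃ g : A[X], g.map (algebraMap A K) = C c * f ∧
      ∃ u : ResidueField A, u ≠ 0 ∧ g.map (residue A) = C u * redPoly A f := by
  have hle : gaussVal A (C c * f) ≤ 1 := by rw [gaussVal_C_mul, hc]
  obtain ⟨g, hg⟩ := exists_map_eq_of_gaussVal_le_one A hle
  have hg0 : g.map (residue A) ≠ 0 := by
    intro h0
    have := (gaussVal_map_lt_one_iff A g).mpr h0
    rw [hg, gaussVal_C_mul, hc] at this
    exact lt_irrefl _ this
  exact ⟨g, hg, exists_map_residue_eq_C_mul_redPoly hs hg hg0⟩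

/-- **Perturbation.**  Adding a polynomial of strictly smaller Gauss value does not change the
reduction: `redRoots (f + g) = redRoots f` if `gaussVal g < gaussVal f`. [folklore] -/
theorem redRoots_add_of_gaussVal_lt [Nontrivial (ResidueField A)] {f g : K[X]} (hs : f.Splits)
    (hs' : (f + g).Splits) (hlt : gaussVal A g < gaussVal A f) : redRoots A (f + g) = redRoots A f := by
  have hf : f ≠ 0 := by
    rintro rfl; rw [gaussVal_zero] at hlt; exact (not_lt.mpr (zero_le)) hlt
  obtain ⟨c, hc, g₀, hg₀f, hg₀r⟩ := exists_model A hf hs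
  have h1 : A.valuation c * gaussVal A f = 1 := valuation_mul_gaussVal_eq_one hg₀f hg₀r
  have hglt : gaussVal A (C c * g) < 1 := by
    rw [gaussVal_C_mul, ← h1]
    have hvc : 0 < A.valuation c := zero_lt_iff.mpr ((Valuation.ne_zero_iff _).mpr hc)
    exact mul_lt_mul_of_pos_left hlt hvc
  obtain ⟨g₁, hg₁⟩ := exists_map_eq_of_gaussVal_le_one A hglt.le
  have hg₁r : g₁.map (residue A) = 0 := (gaussVal_map_lt_one_iff A g₁).mp (by rw [hg₁]; exact hglt)
  have hmodel : (g₀ + g₁).map (algebraMap A K) = C c * (f + g) := by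
    rw [Polynomial.map_add, hg₀f, hg₁, mul_add]
  have hred : (g₀ + g₁).map (residue A) = redPoly A f := by
    rw [Polynomial.map_add, hg₀r, hg₁r, add_zero]
  have hne : (g₀ + g₁).map (residue A) ≠ 0 := by rw [hred]; exact redPoly_ne_zero A f
  have := roots_map_residue_eq_redRoots hs' hmodel hne
  rw [hred, roots_redPoly] at this
  exact this.symm

/-- Perturbation, `redPoly` form. [folklore] -/
theorem redPoly_add_of_gaussVal_lt [Nontrivial (ResidueField A)] {f g : K[X]} (hs : f.Splits)
    (hs' : (f + g).Splits) (hlt : gaussVal A g < gaussVal A f) : redPoly A (f + g) = redPoly A f := by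
  unfold redPoly
  rw [redRoots_add_of_gaussVal_lt hs hs' hlt]

/-- Perturbation does not change the number of integral roots. [folklore] -/
theorem card_intRoots_add_of_gaussVal_lt [Nontrivial (ResidueField A)] {f g : K[X]} (hs : f.Splits)
    (hs' : (f + g).Splits) (hlt : gaussVal A g < gaussVal A f) :
    Multiset.card (intRoots A (f + g)) = Multiset.card (intRoots A f) := by
  rw [← natDegree_redPoly, ← natDegree_redPoly, redPoly_add_of_gaussVal_lt hs hs' hlt]

/-- Perturbation does not change the Gauss value. [folklore] -/
theorem gaussVal_add_of_gaussVal_lt {f g : K[X]} (hlt : gaussVal A g < gaussVal A f) :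
    gaussVal A (f + g) = gaussVal A f := by
  apply le_antisymm ((gaussVal_add_le A f g).trans (max_le le_rfl hlt.le))
  by_contra h
  rw [not_le] at h
  have : gaussVal A f ≤ max (gaussVal A (f + g)) (gaussVal A (-g)) := by
    have e : f = (f + g) + (-g) := by ring
    conv_lhs => rw [e]
    exact gaussVal_add_le A _ _
  rw [gaussVal_neg] at this
  exact absurd (lt_of_le_of_lt this (max_lt h hlt)) (lt_irrefl _)

end Lift

/-! ### Deep pairs -/

section Deep

variable {K : Type*} [Field K] [IsAlgClosed K] [CharZero K] (A : ValuationSubring K)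
variable {d : ℕ} {p q : K[X]}

omit [IsAlgClosed K] [CharZero K] in
/-- `r_Y(a) ≤ v(a)`. [folklore] -/
theorem rY_le_valuation (a : K) : rY A a ≤ A.valuation a := min_le_left _ _

omit [IsAlgClosed K] [CharZero K] in
/-- `r_Y(a) ≤ v(a - 1)`. [folklore] -/
theorem rY_le_valuation_sub_one (a : K) : rY A a ≤ A.valuation (a - 1) := min_le_right _ _

omit [IsAlgClosed K] [CharZero K] in
/-- Two centres closer than `r_Y` have the same `r_Y`. [folklore] -/
theorem rY_eq_of_valuation_sub_lt {a a' : K} (h : A.valuation (a - a') < rY A a') : rY A a = rY A a' := by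
  have h0 : A.valuation (a - a') < A.valuation a' := lt_of_lt_of_le h (rY_le_valuation A a')
  have h1 : A.valuation (a - a') < A.valuation (a' - 1) :=
    lt_of_lt_of_le h (rY_le_valuation_sub_one A a')
  have e0 : A.valuation a = A.valuation a' := by
    have : a = a' + (a - a') := by ring
    rw [this]; exact A.valuation.map_add_eq_of_lt_left h0
  have e1 : A.valuation (a - 1) = A.valuation (a' - 1) := by
    have : a - 1 = a' - 1 + (a - a') := by ring
    rw [this]; exact A.valuation.map_add_eq_of_lt_left h1
  unfold rY
  rw [e0, e1]

omit [IsAlgClosed K] [CharZero K] in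
/-- `redPoly` ignores non-zero constant factors. [folklore] -/
theorem redPoly_C_mul {c : K} (hc : c ≠ 0) (f : K[X]) : redPoly A (C c * f) = redPoly A f := by
  unfold redPoly redRoots intRoots
  rw [roots_C_mul _ hc]

omit [IsAlgClosed K] [CharZero K] in
/-- `intRoots` ignores non-zero constant factors. [folklore] -/
theorem intRoots_C_mul {c : K} (hc : c ≠ 0) (f : K[X]) : intRoots A (C c * f) = intRoots A f := by
  unfold intRoots
  rw [roots_C_mul _ hc]

namespace IsDeepPair

omit [IsAlgClosed K] [CharZero K] in
/-- The witness of depth is neither `0` nor `1`, and `q ≠ 0`. [folklore] -/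
theorem witness_ne {a : K} (ha : gaussVal A (p - C a * q) < rY A a * gaussVal A q) :
    a ≠ 0 ∧ a ≠ 1 := by
  constructor
  · rintro rfl
    have : rY A (0 : K) = 0 := by unfold rY; simp
    rw [this, zero_mul] at ha
    exact (not_lt.mpr zero_le) ha
  · rintro rfl
    have : rY A (1 : K) = 0 := by unfold rY; simp
    rw [this, zero_mul] at ha
    exact (not_lt.mpr zero_le) ha

omit [CharZero K] in
/-- **A deep pair is fully neutral (I)**: `p` and `q` have the same reduction. [folklore] -/
theorem redPoly_left_eq (hdeep : IsDeepPair A p q) : redPoly A p = redPoly A q := by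
  obtain ⟨a, ha⟩ := hdeep
  obtain ⟨ha0, -⟩ := witness_ne A ha
  have hlt : gaussVal A (p - C a * q) < gaussVal A (C a * q) := by
    rw [gaussVal_C_mul]
    exact lt_of_lt_of_le ha (mul_le_mul_left (rY_le_valuation A a) _)
  have : p = C a * q + (p - C a * q) := by ring
  rw [this, redPoly_add_of_gaussVal_lt (IsAlgClosed.splits _) (IsAlgClosed.splits _) hlt,
    redPoly_C_mul A ha0]

omit [CharZero K] in
/-- **A deep pair is fully neutral (II)**: `p - q` and `q` have the same reduction. [folklore] -/
theorem redPoly_sub_eq (hdeep : IsDeepPair A p q) : redPoly A (p - q) = redPoly A q := by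
  obtain ⟨a, ha⟩ := hdeep
  obtain ⟨-, ha1⟩ := witness_ne A ha
  have ha1' : a - 1 ≠ 0 := sub_ne_zero.mpr ha1
  have hlt : gaussVal A (p - C a * q) < gaussVal A (C (a - 1) * q) := by
    rw [gaussVal_C_mul]
    exact lt_of_lt_of_le ha (mul_le_mul_left (rY_le_valuation_sub_one A a) _)
  have : p - q = C (a - 1) * q + (p - C a * q) := by rw [map_sub, C_1]; ring
  rw [this, redPoly_add_of_gaussVal_lt (IsAlgClosed.splits _) (IsAlgClosed.splits _) hlt,
    redPoly_C_mul A ha1']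

omit [CharZero K] in
/-- At a deep pair the counts agree: `n_p = n_q`. [folklore] -/
theorem card_intRoots_left_eq (hdeep : IsDeepPair A p q) :
    Multiset.card (intRoots A p) = Multiset.card (intRoots A q) := by
  rw [← natDegree_redPoly, ← natDegree_redPoly, redPoly_left_eq A hdeep]

omit [CharZero K] in
/-- At a deep pair the counts agree: `n_{p-q} = n_q`. [folklore] -/
theorem card_intRoots_sub_eq (hdeep : IsDeepPair A p q) :
    Multiset.card (intRoots A (p - q)) = Multiset.card (intRoots A q) := by
  rw [← natDegree_redPoly, ← natDegree_redPoly, redPoly_sub_eq A hdeep]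

omit [CharZero K] in
/-- At a deep pair every integral special point reduces to a root of `redPoly q` (the residue
classes with special points are exactly the roots of `redPoly q`). [folklore] -/
theorem count_redRoots_pos_of_mem_roots (hdeep : IsDeepPair A p q) {d : ℕ} (h : IsBelyiPair d p q)
    {s : K} (hs : s ∈ (p * q * (p - q)).roots) (hsA : s ∈ A) :
    0 < (redRoots A q).count (residue A ⟨s, hsA⟩) := by
  have key : ∀ {f : K[X]}, s ∈ f.roots → redPoly A f = redPoly A q →
      0 < (redRoots A q).count (residue A ⟨s, hsA⟩) := by
    intro f hf hred
    have hmem : (⟨s, hsA⟩ : A) ∈ intRoots A f := (mem_intRoots A).mpr hf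
    have : residue A ⟨s, hsA⟩ ∈ redRoots A f := Multiset.mem_map_of_mem _ hmem
    rw [← roots_redPoly, hred, roots_redPoly] at this
    exact Multiset.count_pos.mpr this
  rw [h.roots_prod, Multiset.mem_add, Multiset.mem_add] at hs
  rcases hs with (hs | hs) | hs
  · exact key hs (redPoly_left_eq A hdeep)
  · exact key hs rfl
  · exact key hs (redPoly_sub_eq A hdeep)

end IsDeepPair

omit [CharZero K] in
/-- **The formula centre is as deep as any centre.**  If the pair is deep for `a'`, then for the
formula centre `a`: `gaussVal (p - a q) ≤ gaussVal (p - a' q)`, `v(a - a') < r_Y(a')` and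
`r_Y(a) = r_Y(a')`; in particular the pair is deep for `a`. [folklore] -/
theorem IsBelyiPair.centre_spec (h : IsBelyiPair d p q) {a' : K}
    (ha' : gaussVal A (p - C a' * q) < rY A a' * gaussVal A q) :
    gaussVal A (p - C (centre A p q) * q) ≤ gaussVal A (p - C a' * q) ∧
      A.valuation (centre A p q - a') < rY A a' ∧ rY A (centre A p q) = rY A a' := by
  set a := centre A p q with ha
  have hmin := (h.optimal_centre A rfl ha).1 a'
  have hq := h.right_ne_zero
  have hgq : 0 < gaussVal A q := zero_lt_iff.mpr (gaussVal_ne_zero A hq)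
  have hdiff : A.valuation (a - a') * gaussVal A q ≤ gaussVal A (p - C a' * q) := by
    have e : C (a - a') * q = (p - C a' * q) - (p - C a * q) := by rw [map_sub]; ring
    rw [← gaussVal_C_mul, e]
    exact (gaussVal_sub_le A _ _).trans (max_le le_rfl hmin)
  have hlt : A.valuation (a - a') < rY A a' :=
    lt_of_mul_lt_mul_right' (lt_of_le_of_lt hdiff ha')
  exact ⟨hmin, hlt, rY_eq_of_valuation_sub_lt A hlt⟩

omit [CharZero K] in
/-- A deep pair is deep for its formula centre. [folklore] -/
theorem IsBelyiPair.gaussVal_sub_centre_lt (h : IsBelyiPair d p q) (hdeep : IsDeepPair A p q) :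
    gaussVal A (p - C (centre A p q) * q) < rY A (centre A p q) * gaussVal A q := by
  obtain ⟨a', ha'⟩ := hdeep
  obtain ⟨hle, -, hrY⟩ := h.centre_spec A ha'
  rw [hrY]
  exact lt_of_le_of_lt hle ha'

/-! ### The reduction chart at the Gauss point -/

omit [CharZero K] in
/-- **The chart.**  For a Belyi pair and its formula centre `a` there are `b ≠ 0` with
`v(b) · gaussVal q = gaussVal (p - a q)`, a constant `c₁ ≠ 0` and integral models
`gP = c₁ (p - a q)`, `gQ = c₁ b q` with reductions `redPoly (p - a q)` and `u · redPoly q` (`u ≠ 0`):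
the reduction of `(p - a q)/(b q)` is `redPoly (p - a q) / (u · redPoly q)`. [folklore] -/
theorem IsBelyiPair.exists_chart (h : IsBelyiPair d p q) :
    ∃ (b c₁ : K) (gP gQ : A[X]) (u : ResidueField A), b ≠ 0 ∧ c₁ ≠ 0 ∧ u ≠ 0 ∧
      A.valuation b * gaussVal A q = gaussVal A (p - C (centre A p q) * q) ∧
      gP.map (algebraMap A K) = C c₁ * (p - C (centre A p q) * q) ∧
      gP.map (residue A) = redPoly A (p - C (centre A p q) * q) ∧
      gQ.map (algebraMap A K) = C (c₁ * b) * q ∧ gQ.map (residue A) = C u * redPoly A q := by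
  set a := centre A p q with ha
  have hq := h.right_ne_zero
  have hP := h.sub_C_mul_ne_zero a
  obtain ⟨b, hb⟩ := A.valuation_surjective (gaussVal A (p - C a * q) / gaussVal A q)
  have hgq : gaussVal A q ≠ 0 := gaussVal_ne_zero A hq
  have hbq : A.valuation b * gaussVal A q = gaussVal A (p - C a * q) := by
    rw [hb, div_mul_cancel₀ _ hgq]
  have hb0 : b ≠ 0 := by
    intro h0
    rw [h0, map_zero, zero_mul] at hbq
    exact gaussVal_ne_zero A hP hbq.symm
  obtain ⟨c₁, hc₁, gP, hgPf, hgPr⟩ := exists_model A hP (IsAlgClosed.splits _)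
  have h1 : A.valuation c₁ * gaussVal A (p - C a * q) = 1 := valuation_mul_gaussVal_eq_one hgPf hgPr
  have h2 : A.valuation (c₁ * b) * gaussVal A q = 1 := by rw [map_mul, mul_assoc, hbq, h1]
  obtain ⟨gQ, hgQf, u, hu, hgQr⟩ := exists_lift_eq_C_mul (IsAlgClosed.splits q) h2
  exact ⟨b, c₁, gP, gQ, u, hb0, hc₁, hu, hbq, hgPf, hgPr, hgQf, hgQr⟩

omit [IsAlgClosed K] [CharZero K] in
/-- **Shifting the centre inside the chart.**  With the data of `exists_chart` and `t ∈ A`,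
`gP - t gQ` is an integral model of `c₁ (p - (a + b t) q)` with reduction
`redPoly (p - a q) - (t̄ u) · redPoly q`. [folklore] -/
theorem chart_shift {a b c₁ : K} {gP gQ : A[X]} {u : ResidueField A}
    (hgPf : gP.map (algebraMap A K) = C c₁ * (p - C a * q))
    (hgPr : gP.map (residue A) = redPoly A (p - C a * q))
    (hgQf : gQ.map (algebraMap A K) = C (c₁ * b) * q) (hgQr : gQ.map (residue A) = C u * redPoly A q)
    (t : A) :
    (gP - C t * gQ).map (algebraMap A K) = C c₁ * (p - C (a + b * t) * q) ∧
      (gP - C t * gQ).map (residue A) = redPoly A (p - C a * q) - C (residue A t * u) * redPoly A q := by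
  constructor
  · rw [Polynomial.map_sub, Polynomial.map_mul, map_C, hgPf, hgQf, ValuationSubring.algebraMap_apply,
      map_add, map_mul, map_mul]
    ring
  · rw [Polynomial.map_sub, Polynomial.map_mul, map_C, hgPr, hgQr, ← mul_assoc, ← C_mul]

omit [IsAlgClosed K] [CharZero K] in
/-- Two monic polynomials that are constant multiples of each other are equal. [folklore] -/
theorem eq_of_monic_of_eq_C_mul {R : Type*} [CommRing R] [IsDomain R] {P Q : R[X]} (hP : P.Monic)
    (hQ : Q.Monic) {w : R} (h : P = C w * Q) : P = Q := by
  have hw : w ≠ 0 := by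
    rintro rfl
    rw [C_0, zero_mul] at h
    exact hP.ne_zero h
  have hlc := congrArg leadingCoeff h
  rw [leadingCoeff_mul, leadingCoeff_C, hP.leadingCoeff, hQ.leadingCoeff, mul_one] at hlc
  rw [h, ← hlc, C_1, one_mul]

omit [CharZero K] in
/-- In the chart, the shifted reduction `redPoly (p - a q) - w · redPoly q` is never zero
(`a` the formula centre): otherwise the reduction of `(p - a q)/(b q)` would be constant.
[folklore] -/
theorem IsBelyiPair.redPoly_sub_C_mul_redPoly_ne_zero (h : IsBelyiPair d p q) (w : ResidueField A) :
    redPoly A (p - C (centre A p q) * q) - C w * redPoly A q ≠ 0 := by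
  intro h0
  rw [sub_eq_zero] at h0
  exact (h.optimal_centre A rfl rfl).2 (eq_of_monic_of_eq_C_mul (monic_redPoly A _) (monic_redPoly A _) h0)

omit [CharZero K] in
/-- **Counting through the chart.**  For `λ = a + b t` the roots of `p - λ q` in a residue class are
counted by the shifted reduction: `#(redRoots (p - λ q)) ∩ {x} = ord_x (redPoly (p - a q) - t̄ u · redPoly q)`.
[folklore] -/
theorem IsBelyiPair.count_redRoots_shift (h : IsBelyiPair d p q) {b c₁ : K} {gP gQ : A[X]}
    {u : ResidueField A}
    (hgPf : gP.map (algebraMap A K) = C c₁ * (p - C (centre A p q) * q))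
    (hgPr : gP.map (residue A) = redPoly A (p - C (centre A p q) * q))
    (hgQf : gQ.map (algebraMap A K) = C (c₁ * b) * q) (hgQr : gQ.map (residue A) = C u * redPoly A q)
    (t : A) (x : ResidueField A) :
    (redRoots A (p - C (centre A p q + b * t) * q)).count x =
      (redPoly A (p - C (centre A p q) * q) - C (residue A t * u) * redPoly A q).rootMultiplicity x := by
  obtain ⟨hf, hr⟩ := chart_shift A hgPf hgPr hgQf hgQr t
  have hne : (gP - C t * gQ).map (residue A) ≠ 0 := by
    rw [hr]; exact h.redPoly_sub_C_mul_redPoly_ne_zero A _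
  have hroots := roots_map_residue_eq_redRoots (IsAlgClosed.splits _) hf hne
  rw [← hroots, count_roots, hr]

omit [CharZero K] in
/-- In the chart, the Gauss value of `p - λ q` for `λ = a + b t` equals that of `p - a q`.
[folklore] -/
theorem IsBelyiPair.gaussVal_shift (h : IsBelyiPair d p q) {b c₁ : K} {gP gQ : A[X]}
    {u : ResidueField A} (hc₁ : c₁ ≠ 0)
    (hgPf : gP.map (algebraMap A K) = C c₁ * (p - C (centre A p q) * q))
    (hgPr : gP.map (residue A) = redPoly A (p - C (centre A p q) * q))
    (hgQf : gQ.map (algebraMap A K) = C (c₁ * b) * q) (hgQr : gQ.map (residue A) = C u * redPoly A q)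
    (t : A) :
    gaussVal A (p - C (centre A p q + b * t) * q) = gaussVal A (p - C (centre A p q) * q) := by
  obtain ⟨hf, hr⟩ := chart_shift A hgPf hgPr hgQf hgQr t
  have hne : (gP - C t * gQ).map (residue A) ≠ 0 := by
    rw [hr]; exact h.redPoly_sub_C_mul_redPoly_ne_zero A _
  have h1 : A.valuation c₁ * gaussVal A (p - C (centre A p q + b * t) * q) = 1 := by
    rw [← gaussVal_C_mul, ← hf]; exact gaussVal_map_eq_one A hne
  have h2 : A.valuation c₁ * gaussVal A (p - C (centre A p q) * q) = 1 :=
    valuation_mul_gaussVal_eq_one hgPf hgPr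
  have hvc : A.valuation c₁ ≠ 0 := (Valuation.ne_zero_iff _).mpr hc₁
  exact mul_left_cancel₀ hvc (h1.trans h2.symm)

end Deep

/-! ### Entering a class that is not a pole; the all-shallow contradiction -/

section Entering

variable {K : Type*} [Field K] [IsAlgClosed K] [CharZero K] (A : ValuationSubring K)
variable {d : ℕ} {p q : K[X]}

omit [CharZero K] in
/-- **Entering lemma.**  In the chart of a Belyi pair (formula centre `a`, scale `b`), let `v` be a
residue class at which the reduction `P̃ = redPoly (p - a q)` vanishes to order at least that of
`Q̃ = redPoly q` (the class is NOT a pole of `P̃/Q̃`).  Then for a suitable `t ∈ A`, the class `v`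
contains strictly more roots of `p - (a + b t) q` than of `q`. [folklore] -/
theorem IsBelyiPair.entering (h : IsBelyiPair d p q) {b c₁ : K} {gP gQ : A[X]} {u : ResidueField A}
    (hu : u ≠ 0)
    (hgPf : gP.map (algebraMap A K) = C c₁ * (p - C (centre A p q) * q))
    (hgPr : gP.map (residue A) = redPoly A (p - C (centre A p q) * q))
    (hgQf : gQ.map (algebraMap A K) = C (c₁ * b) * q) (hgQr : gQ.map (residue A) = C u * redPoly A q)
    {v : ResidueField A}
    (hv : (redPoly A q).rootMultiplicity v ≤ (redPoly A (p - C (centre A p q) * q)).rootMultiplicity v) :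
    ∃ t : A, (redRoots A q).count v < (redRoots A (p - C (centre A p q + b * t) * q)).count v := by
  set a := centre A p q with ha
  set Pt := redPoly A (p - C a * q) with hPt
  set Qt := redPoly A q with hQt
  have hPt0 : Pt ≠ 0 := (monic_redPoly A _).ne_zero
  have hQt0 : Qt ≠ 0 := (monic_redPoly A _).ne_zero
  set μ := Qt.rootMultiplicity v with hμ
  -- factor `(X - v)^μ` from both
  set Q₁ := Qt /ₘ (X - C v) ^ μ with hQ₁
  have hQfac : (X - C v) ^ μ * Q₁ = Qt := pow_mul_divByMonic_rootMultiplicity_eq Qt v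
  have hQ₁v : Q₁.eval v ≠ 0 := by
    rw [hQ₁, hμ]; exact eval_divByMonic_pow_rootMultiplicity_ne_zero v hQt0
  obtain ⟨P₁, hPfac⟩ : (X - C v) ^ μ ∣ Pt := (le_rootMultiplicity_iff hPt0).mp hv
  -- the value `w u` of the reduction at `v`, and a lift `t` of `w`
  set w : ResidueField A := P₁.eval v / Q₁.eval v * u⁻¹ with hw
  obtain ⟨t, ht⟩ := residue_surjective (R := A) w
  refine ⟨t, ?_⟩
  have hwu : residue A t * u = P₁.eval v / Q₁.eval v := by
    rw [ht, hw, inv_mul_cancel_right₀ hu]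
  -- the shifted reduction vanishes to order `≥ μ + 1` at `v`
  set R := Pt - C (residue A t * u) * Qt with hR
  have hR0 : R ≠ 0 := h.redPoly_sub_C_mul_redPoly_ne_zero A _
  have hRfac : R = (X - C v) ^ μ * (P₁ - C (residue A t * u) * Q₁) := by
    rw [hR, hPfac, ← hQfac]; ring
  have hbr : (X - C v) ∣ (P₁ - C (residue A t * u) * Q₁) := by
    rw [dvd_iff_isRoot, IsRoot.def, eval_sub, eval_mul, eval_C, hwu, div_mul_cancel₀ _ hQ₁v, sub_self]
  have hdvd : (X - C v) ^ (μ + 1) ∣ R := by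
    rw [hRfac, pow_succ]
    exact mul_dvd_mul_left _ hbr
  have hmult : μ + 1 ≤ R.rootMultiplicity v := (le_rootMultiplicity_iff hR0).mpr hdvd
  rw [h.count_redRoots_shift A hgPf hgPr hgQf hgQr t v, ← hR, ← rootMultiplicity_redPoly, ← hQt, ← hμ]
  omega

omit [CharZero K] in
/-- `gcd` bookkeeping: if `G ∣ P` then `ord_x (P/G·G) …`; packaged as: for `Q = G * Q₁`,
`ord_x Q₁ = ord_x Q - ord_x G`. [folklore] -/
theorem rootMultiplicity_eq_sub_of_mul_eq {k : Type*} [Field k] {G Q Q₁ : k[X]} (hQ : Q ≠ 0)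
    (h : G * Q₁ = Q) (x : k) : Q₁.rootMultiplicity x = Q.rootMultiplicity x - G.rootMultiplicity x := by
  have hGQ : G * Q₁ ≠ 0 := by rw [h]; exact hQ
  rw [← h, rootMultiplicity_mul hGQ]
  omega

/-- **The all-shallow contradiction.**  A tame deep Belyi pair at whose Gauss point some residue
class contains special points cannot have every such class a pole of the reduction
`χ = redPoly (p - a q) / (u · redPoly q)` (`a` the formula centre) while `∞` is a pole too
(`n_q < n_{p - a q}`).  (Cancel the gcd; the special-free classes are unramified for `χ` by
`count_redRoots_sub_C_mul_le_one`; the two-point Riemann–Hurwitz count leaves no finite pole.)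
[folklore] -/
theorem IsBelyiPair.false_of_forall_shallow (h : IsBelyiPair d p q)
    (htame : ∀ m : ℕ, 0 < m → m ≤ d → (m : ResidueField A) ≠ 0) (hdeep : IsDeepPair A p q)
    {v₀ : ResidueField A} (hv₀ : 0 < (redRoots A q).count v₀)
    (hinner : ∀ v, 0 < (redRoots A q).count v →
      (redPoly A (p - C (centre A p q) * q)).rootMultiplicity v < (redPoly A q).rootMultiplicity v)
    (houter : Multiset.card (intRoots A q) < Multiset.card (intRoots A (p - C (centre A p q) * q))) :
    False := by
  haveI : IsAlgClosed (ResidueField A) := Literature.RingTheory.Valuation.isAlgClosed_residueField A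
  obtain ⟨b, c₁, gP, gQ, u, hb0, hc₁, hu, hbq, hgPf, hgPr, hgQf, hgQr⟩ := h.exists_chart A
  set a := centre A p q with ha
  set Pt := redPoly A (p - C a * q) with hPt
  set Qt := redPoly A q with hQt
  have hPt0 : Pt ≠ 0 := (monic_redPoly A _).ne_zero
  have hQt0 : Qt ≠ 0 := (monic_redPoly A _).ne_zero
  -- cancel the gcd
  set G := GCDMonoid.gcd Pt Qt with hG
  have hG0 : G ≠ 0 := gcd_ne_zero_of_right hQt0
  set P₁ := Pt / G with hP₁
  set Q₁ := Qt / G with hQ₁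
  have hPfac : G * P₁ = Pt := EuclideanDomain.mul_div_cancel' hG0 (gcd_dvd_left _ _)
  have hQfac : G * Q₁ = Qt := EuclideanDomain.mul_div_cancel' hG0 (gcd_dvd_right _ _)
  have hcop : IsCoprime P₁ Q₁ := isCoprime_div_gcd_div_gcd hQt0
  have hP₁0 : P₁ ≠ 0 := fun h0 => hPt0 (by rw [← hPfac, h0, mul_zero])
  have hQ₁0 : Q₁ ≠ 0 := fun h0 => hQt0 (by rw [← hQfac, h0, mul_zero])
  -- degrees
  have hdegP : Pt.natDegree = G.natDegree + P₁.natDegree := by rw [← hPfac, natDegree_mul hG0 hP₁0]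
  have hdegQ : Qt.natDegree = G.natDegree + Q₁.natDegree := by rw [← hQfac, natDegree_mul hG0 hQ₁0]
  have hnP : Pt.natDegree = Multiset.card (intRoots A (p - C a * q)) := natDegree_redPoly A _
  have hnQ : Qt.natDegree = Multiset.card (intRoots A q) := natDegree_redPoly A _
  have hdeg : Q₁.natDegree < P₁.natDegree := by omega
  have hP₁d : P₁.natDegree ≤ d := by
    have := card_intRoots_le_natDegree A (p - C a * q)
    have := h.natDegree_sub_C_mul_le a
    omega
  have htame' : ∀ m : ℕ, 0 < m → m ≤ max P₁.natDegree Q₁.natDegree → (m : ResidueField A) ≠ 0 := by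
    intro m hm hle
    refine htame m hm (hle.trans (max_le hP₁d ?_))
    omega
  -- poles of `χ` and roots of `Q₁`: a root `x` of `Qt` with `ord_x Pt < ord_x Qt` is a root of `Q₁`
  have hpole : ∀ x, Pt.rootMultiplicity x < Qt.rootMultiplicity x → Q₁.IsRoot x := by
    intro x hx
    have hGle : G.rootMultiplicity x ≤ Pt.rootMultiplicity x :=
      rootMultiplicity_le_rootMultiplicity_of_dvd hPt0 (gcd_dvd_left _ _) x
    have : 0 < Q₁.rootMultiplicity x := by
      rw [rootMultiplicity_eq_sub_of_mul_eq hQt0 hQfac x]; omega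
    exact (rootMultiplicity_pos hQ₁0).mp this
  -- unramified off the zeros and poles
  have hunram : ∀ x : ResidueField A, P₁.eval x ≠ 0 → Q₁.eval x ≠ 0 →
      (P₁ * C (Q₁.eval x) - Q₁ * C (P₁.eval x)).rootMultiplicity x ≤ 1 := by
    intro x hPx hQx
    -- the class `x` contains no special point
    have hQtx : (redRoots A q).count x = 0 := by
      by_contra hne
      have hpos : 0 < (redRoots A q).count x := Nat.pos_of_ne_zero hne
      have := hinner x hpos
      exact hQx (hpole x this).eq_zero
    have hfree : ∀ s ∈ (p * q * (p - q)).roots, ∀ hs : s ∈ A, residue A ⟨s, hs⟩ ≠ x := by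
      intro s hs hsA hres
      have := IsDeepPair.count_redRoots_pos_of_mem_roots A hdeep h hs hsA
      rw [hres, hQtx] at this
      exact lt_irrefl 0 this
    -- the value at `x` and its lift
    set w : ResidueField A := P₁.eval x / Q₁.eval x with hw
    obtain ⟨t, ht⟩ := residue_surjective (R := A) (w * u⁻¹)
    have hwu : residue A t * u = w := by rw [ht, inv_mul_cancel_right₀ hu]
    have hcount := h.count_redRoots_sub_C_mul_le_one A htame hfree (a + b * t)
    rw [h.count_redRoots_shift A hgPf hgPr hgQf hgQr t x, hwu] at hcount
    -- compare multiplicities along `Pt - w Qt = G (P₁ - w Q₁)` and the constant `Q₁(x)`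
    have hR0 : Pt - C w * Qt ≠ 0 := h.redPoly_sub_C_mul_redPoly_ne_zero A w
    have hRfac : Pt - C w * Qt = G * (P₁ - C w * Q₁) := by rw [← hPfac, ← hQfac]; ring
    have hS0 : P₁ - C w * Q₁ ≠ 0 := fun h0 => hR0 (by rw [hRfac, h0, mul_zero])
    have h1 : (P₁ - C w * Q₁).rootMultiplicity x ≤ (Pt - C w * Qt).rootMultiplicity x := by
      rw [hRfac, rootMultiplicity_mul (by rw [← hRfac]; exact hR0)]
      omega
    have h2 : P₁ * C (Q₁.eval x) - Q₁ * C (P₁.eval x) = C (Q₁.eval x) * (P₁ - C w * Q₁) := by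
      rw [hw, mul_sub, ← mul_assoc, ← C_mul, mul_div_cancel₀ _ hQx]; ring
    rw [h2, rootMultiplicity_mul (mul_ne_zero (by rwa [Ne, C_eq_zero]) hS0), rootMultiplicity_C,
      zero_add]
    exact h1.trans hcount
  -- two-point Riemann–Hurwitz
  have hcount := card_roots_toFinset_add_eq_one hcop (Ne.symm (Nat.ne_of_lt hdeg)) htame' hunram
  -- but `v₀` gives a root of `Q₁`
  have hv₀' : Q₁.IsRoot v₀ := hpole v₀ (hinner v₀ hv₀)
  have hQ₁card : 1 ≤ Q₁.roots.toFinset.card :=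
    Finset.card_pos.mpr ⟨v₀, Multiset.mem_toFinset.mpr ((mem_roots hQ₁0).mpr hv₀')⟩
  have hP₁card : P₁.roots.toFinset.card = 0 := by omega
  have hP₁deg : P₁.natDegree = 0 := by
    rw [(IsAlgClosed.splits P₁).natDegree_eq_card_roots]
    have : P₁.roots.toFinset = ∅ := Finset.card_eq_zero.mp hP₁card
    rw [Multiset.toFinset_eq_empty] at this
    rw [this, Multiset.card_zero]
  omega

end Entering

end Literature.NumberTheory.DiophantineGeometry

end
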